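import Literature.MathematicalPhysics.QuantumLattice.GrassmannLinearSubstitution
import Literature.MathematicalPhysics.QuantumLattice.GrassmannKernelsPresented
import HarnessLib

/-!
# Young's inequality for the `L¹–L^∞` kernel norm under linear substitutions of the fields

Topic `MathematicalPhysics/QuantumLattice`; companion of `GrassmannLinearSubstitution.lean` (`kernel_map`: the
kernels of `map f F` are the kernels of `F` convolved on every leg with the matrix `M = toMatrix' f`) and of
`GrassmannKernels.lean` / `GrassmannKernelsPresented.lean` (Salmhofer's norm `kernelNorm ε m`: one leg pinned,
the others summed with weight `ε`).  For a two-index kernel `Mf : Γ' → Γ → 𝕜` with row sums of norms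
`≤ cr` and column sums of norms `≤ cc`, the multi-leg transform `K ↦ (X' ↦ Σ_X (∏ᵢ Mf (X'ᵢ) (Xᵢ)) K X)`
is bounded leg by leg (the pinned leg costs a row sum, each summed leg a column sum):

* `sum_filter_prod_norm_eq` — the pinned sum of a product kernel factorises:
  `Σ_{X' : X'_p = w'} ∏ᵢ ‖Mf (X'ᵢ) (Xᵢ)‖ = ‖Mf w' X_p‖ · ∏_{i ≠ p} Σ_{y'} ‖Mf y' Xᵢ‖`;
* **`sum_filter_norm_transform_le`** — `ε^m Σ_{X' : X'_p = w'} ‖Σ_X (∏ᵢ Mf X'ᵢ Xᵢ) K X‖ ≤ cr · cc^m · ‖K‖`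
  in degree `m + 1`; `kernelNorm_transform_le` (the same for the norm);
* **`kernelNorm_kernel_map_le`** — for a linear substitution `f` of the generators with matrix `M`:
  `‖kernel (map f F) (m+1)‖ ≤ cr · cc^m · ‖kernel F (m+1)‖` (BGM 2006, (2.71a)/(2.82): sectorising the
  external legs of a kernel costs the `L¹` norms of the sector multipliers, once per leg); `kernel_map_zero_eq`
  (degree `0` is unchanged).

Everything is proved; no definitions, no named facts.

## Sources

G. Benfatto, A. Giuliani, V. Mastropietro, Ann. Henri Poincaré 7 (2006) 809–898, (2.70)–(2.71a), (2.82)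
[`BenfattoGiulianiMastropietro2006`]; M. Salmhofer, Commun. Math. Phys. 194 (1998) 249–295, §4.1
[`Salmhofer1998`].  Routine ("folklore": Young's inequality on a finite measure space).
-/

noncomputable section

namespace Literature.MathematicalPhysics.QuantumLattice

open GrassmannAlgebra Finset

variable {𝕜 : Type*} [RCLike 𝕜] {Γ Γ' : Type*} [Fintype Γ] [DecidableEq Γ] [Fintype Γ'] [DecidableEq Γ']

omit [Fintype Γ] [DecidableEq Γ] in
/-- **The pinned sum of a product kernel factorises**:
`Σ_{X' : X'_p = w'} ∏ᵢ ‖Mf (X'ᵢ) (Xᵢ)‖ = ‖Mf w' X_p‖ · ∏_{i ≠ p} Σ_{y'} ‖Mf y' Xᵢ‖`. [folklore] -/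
theorem sum_filter_prod_norm_eq {m : ℕ} (Mf : Γ' → Γ → 𝕜) (X : Fin (m + 1) → Γ) (p : Fin (m + 1)) (w' : Γ') :
    ∑ X' ∈ univ.filter (fun X' : Fin (m + 1) → Γ' => X' p = w'), ∏ i, ‖Mf (X' i) (X i)‖ =
      ‖Mf w' (X p)‖ * ∏ i ∈ univ.erase p, ∑ y', ‖Mf y' (X i)‖ := by
  set t : Fin (m + 1) → Finset Γ' := fun i => if i = p then {w'} else univ with ht
  have hfilter : univ.filter (fun X' : Fin (m + 1) → Γ' => X' p = w') = Fintype.piFinset t := by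
    ext X'
    simp only [mem_filter, mem_univ, true_and, Fintype.mem_piFinset, ht]
    constructor
    · intro h i
      split_ifs with hi
      · subst hi; simp [h]
      · exact mem_univ _
    · intro h
      simpa using h p
  rw [hfilter, ← prod_univ_sum t (fun i y => ‖Mf y (X i)‖), ← mul_prod_erase univ _ (mem_univ p)]
  congr 1
  · simp [ht]
  · refine prod_congr rfl fun i hi => ?_
    rw [ht]
    dsimp only
    rw [if_neg (ne_of_mem_erase hi)]

omit [DecidableEq Γ'] [Fintype Γ] [DecidableEq Γ] [Fintype Γ'] in
/-- A product of `m` nonnegative factors each at most `c` is at most `c^m`. [folklore] -/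
theorem prod_erase_le_pow {m : ℕ} (p : Fin (m + 1)) (g : Fin (m + 1) → ℝ) (hg0 : ∀ i, 0 ≤ g i) {c : ℝ}
    (hg : ∀ i, g i ≤ c) : ∏ i ∈ univ.erase p, g i ≤ c ^ m := by
  calc ∏ i ∈ univ.erase p, g i ≤ ∏ _i ∈ univ.erase p, c := prod_le_prod (fun i _ => hg0 i) fun i _ => hg i
    _ = c ^ m := by rw [prod_const, card_erase_of_mem (mem_univ p), card_univ, Fintype.card_fin, Nat.add_sub_cancel]

/-- **Young's inequality for the multi-leg transform, one leg pinned**: with row sums of `‖Mf‖` at most `cr`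
and column sums at most `cc`, in degree `m + 1`,
`ε^m Σ_{X' : X'_p = w'} ‖Σ_X (∏ᵢ Mf X'ᵢ Xᵢ) K X‖ ≤ cr · cc^m · ‖K‖` — the pinned leg costs a row sum, each of the
`m` summed legs a column sum. [cite: BenfattoGiulianiMastropietro2006, (2.71a)] -/
theorem sum_filter_norm_transform_le {m : ℕ} (K : (Fin (m + 1) → Γ) → 𝕜) (Mf : Γ' → Γ → 𝕜) {cr cc : ℝ}
    (hcc0 : 0 ≤ cc) (hrow : ∀ y', ∑ x, ‖Mf y' x‖ ≤ cr) (hcol : ∀ x, ∑ y', ‖Mf y' x‖ ≤ cc)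
    {ε : ℝ} (hε : 0 ≤ ε) (p : Fin (m + 1)) (w' : Γ') :
    ε ^ m * ∑ X' ∈ univ.filter (fun X' : Fin (m + 1) → Γ' => X' p = w'),
        ‖∑ X : Fin (m + 1) → Γ, (∏ i, Mf (X' i) (X i)) * K X‖ ≤ cr * cc ^ m * kernelNorm ε (m + 1) K := by
  have hK0 : 0 ≤ kernelNorm ε (m + 1) K := kernelNorm_nonneg hε _ _
  -- (1) triangle inequality and exchange of the sums
  have h1 : ∑ X' ∈ univ.filter (fun X' : Fin (m + 1) → Γ' => X' p = w'),
      ‖∑ X : Fin (m + 1) → Γ, (∏ i, Mf (X' i) (X i)) * K X‖ ≤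
      ∑ X : Fin (m + 1) → Γ, ‖K X‖ * (‖Mf w' (X p)‖ * ∏ i ∈ univ.erase p, ∑ y', ‖Mf y' (X i)‖) := by
    calc ∑ X' ∈ univ.filter (fun X' : Fin (m + 1) → Γ' => X' p = w'), ‖∑ X : Fin (m + 1) → Γ, (∏ i, Mf (X' i) (X i)) * K X‖
        ≤ ∑ X' ∈ univ.filter (fun X' : Fin (m + 1) → Γ' => X' p = w'), ∑ X : Fin (m + 1) → Γ, (∏ i, ‖Mf (X' i) (X i)‖) * ‖K X‖ :=
          sum_le_sum fun X' _ => (norm_sum_le _ _).trans (le_of_eq (sum_congr rfl fun X _ => by rw [norm_mul, norm_prod]))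
      _ = ∑ X : Fin (m + 1) → Γ, ‖K X‖ * ∑ X' ∈ univ.filter (fun X' : Fin (m + 1) → Γ' => X' p = w'), ∏ i, ‖Mf (X' i) (X i)‖ := by
          rw [sum_comm]
          refine sum_congr rfl fun X _ => ?_
          rw [mul_sum]
          exact sum_congr rfl fun X' _ => mul_comm _ _
      _ = _ := sum_congr rfl fun X _ => by rw [sum_filter_prod_norm_eq]
  -- (2) the summed legs cost `cc^m`
  have h2 : ∀ X : Fin (m + 1) → Γ, ‖K X‖ * (‖Mf w' (X p)‖ * ∏ i ∈ univ.erase p, ∑ y', ‖Mf y' (X i)‖) ≤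
      ‖K X‖ * ‖Mf w' (X p)‖ * cc ^ m := by
    intro X
    rw [mul_assoc]
    refine mul_le_mul_of_nonneg_left (mul_le_mul_of_nonneg_left ?_ (norm_nonneg _)) (norm_nonneg _)
    exact prod_erase_le_pow p _ (fun i => sum_nonneg fun _ _ => norm_nonneg _) fun i => hcol (X i)
  -- (3) the pinned leg: fibre over `X p`
  have h3 : ∑ X : Fin (m + 1) → Γ, ‖K X‖ * ‖Mf w' (X p)‖ * cc ^ m =
      cc ^ m * ∑ x, ‖Mf w' x‖ * ∑ X ∈ univ.filter (fun X : Fin (m + 1) → Γ => X p = x), ‖K X‖ := by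
    rw [mul_sum, ← sum_fiberwise univ (fun X : Fin (m + 1) → Γ => X p)]
    refine sum_congr rfl fun x _ => ?_
    rw [mul_sum, mul_sum]
    refine sum_congr rfl fun X hX => ?_
    rw [(mem_filter.1 hX).2]
    ring
  have h4 : ∀ x, ε ^ m * (‖Mf w' x‖ * ∑ X ∈ univ.filter (fun X : Fin (m + 1) → Γ => X p = x), ‖K X‖) ≤
      ‖Mf w' x‖ * kernelNorm ε (m + 1) K := fun x => by
    rw [mul_left_comm]
    exact mul_le_mul_of_nonneg_left (pinnedSum_le_kernelNorm ε m K p x) (norm_nonneg _)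
  calc ε ^ m * ∑ X' ∈ univ.filter (fun X' : Fin (m + 1) → Γ' => X' p = w'),
        ‖∑ X : Fin (m + 1) → Γ, (∏ i, Mf (X' i) (X i)) * K X‖
      ≤ ε ^ m * ∑ X : Fin (m + 1) → Γ, ‖K X‖ * ‖Mf w' (X p)‖ * cc ^ m :=
        mul_le_mul_of_nonneg_left (h1.trans (sum_le_sum fun X _ => h2 X)) (pow_nonneg hε _)
    _ = cc ^ m * ∑ x, ε ^ m * (‖Mf w' x‖ * ∑ X ∈ univ.filter (fun X : Fin (m + 1) → Γ => X p = x), ‖K X‖) := by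
        rw [h3, mul_sum, mul_sum, mul_sum]
        exact sum_congr rfl fun x _ => by ring
    _ ≤ cc ^ m * ∑ x, ‖Mf w' x‖ * kernelNorm ε (m + 1) K :=
        mul_le_mul_of_nonneg_left (sum_le_sum fun x _ => h4 x) (pow_nonneg hcc0 _)
    _ = cc ^ m * ((∑ x, ‖Mf w' x‖) * kernelNorm ε (m + 1) K) := by rw [sum_mul]
    _ ≤ cc ^ m * (cr * kernelNorm ε (m + 1) K) :=
        mul_le_mul_of_nonneg_left (mul_le_mul_of_nonneg_right (hrow w') hK0) (pow_nonneg hcc0 _)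
    _ = cr * cc ^ m * kernelNorm ε (m + 1) K := by ring

/-- **Young's inequality for the `L¹–L^∞` norm of the multi-leg transform**: in degree `m + 1`,
`‖X' ↦ Σ_X (∏ᵢ Mf X'ᵢ Xᵢ) K X‖ ≤ cr · cc^m · ‖K‖`. [cite: BenfattoGiulianiMastropietro2006, (2.71a)] -/
theorem kernelNorm_transform_le {m : ℕ} (K : (Fin (m + 1) → Γ) → 𝕜) (Mf : Γ' → Γ → 𝕜) {cr cc : ℝ} (hcr0 : 0 ≤ cr)
    (hcc0 : 0 ≤ cc) (hrow : ∀ y', ∑ x, ‖Mf y' x‖ ≤ cr) (hcol : ∀ x, ∑ y', ‖Mf y' x‖ ≤ cc) {ε : ℝ} (hε : 0 ≤ ε) :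
    kernelNorm ε (m + 1) (fun X' : Fin (m + 1) → Γ' => ∑ X : Fin (m + 1) → Γ, (∏ i, Mf (X' i) (X i)) * K X) ≤
      cr * cc ^ m * kernelNorm ε (m + 1) K :=
  kernelNorm_succ_le_of_forall ε m _ (by have := kernelNorm_nonneg hε (m + 1) K; positivity) fun p w' =>
    sum_filter_norm_transform_le K Mf hcc0 hrow hcol hε p w'

variable [Algebra ℚ 𝕜]

/-- **Substituting the legs costs one `L¹` norm per leg**: for a linear substitution `f` of the generators
with matrix `M = toMatrix' f` whose row sums of norms are `≤ cr` and column sums `≤ cc`,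
`‖kernel (map f F) (m+1)‖ ≤ cr · cc^m · ‖kernel F (m+1)‖` (BGM 2006, (2.71a)/(2.82): sectorising the external
legs of a kernel costs the `L¹` norms of the sector multipliers, once per leg). [cite: BenfattoGiulianiMastropietro2006, (2.71a)] -/
theorem kernelNorm_kernel_map_le (f : (Γ → 𝕜) →ₗ[𝕜] (Γ' → 𝕜)) {cr cc : ℝ} (hcr0 : 0 ≤ cr) (hcc0 : 0 ≤ cc)
    (hrow : ∀ y', ∑ x, ‖LinearMap.toMatrix' f y' x‖ ≤ cr) (hcol : ∀ x, ∑ y', ‖LinearMap.toMatrix' f y' x‖ ≤ cc)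
    {ε : ℝ} (hε : 0 ≤ ε) (F : GrassmannAlgebra 𝕜 Γ) (m : ℕ) :
    kernelNorm ε (m + 1) (kernel 𝕜 (ExteriorAlgebra.map f F) (m + 1)) ≤
      cr * cc ^ m * kernelNorm ε (m + 1) (kernel 𝕜 F (m + 1)) := by
  have h : kernel 𝕜 (ExteriorAlgebra.map f F) (m + 1) = fun X' : Fin (m + 1) → Γ' =>
      ∑ X : Fin (m + 1) → Γ, (∏ i, LinearMap.toMatrix' f (X' i) (X i)) * kernel 𝕜 F (m + 1) X :=
    funext fun X' => kernel_map 𝕜 f F (m + 1) X'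
  rw [h]
  exact kernelNorm_transform_le _ _ hcr0 hcc0 hrow hcol hε

omit [Fintype Γ] [DecidableEq Γ] [Fintype Γ'] [DecidableEq Γ'] in
/-- In degree `0` a substitution changes nothing: `kernel (map f F) 0 = kernel F 0` (the constant part).
[folklore] -/
theorem kernel_map_zero_eq (f : (Γ → 𝕜) →ₗ[𝕜] (Γ' → 𝕜)) (F : GrassmannAlgebra 𝕜 Γ) (X' : Fin 0 → Γ')
    (X : Fin 0 → Γ) : kernel 𝕜 (ExteriorAlgebra.map f F) 0 X' = kernel 𝕜 F 0 X := by
  rw [kernel_zero, kernel_zero, constPart_map]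

end Literature.MathematicalPhysics.QuantumLattice
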